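/-
Copyright (c) 2026 the pub-hodgecm-mathlib formalisation cell (harness21).  Prover seat hodgecm-mathlib-LH4-p04 (g2), req620 Track A «(D-RAM) FOUR-FRAME» squad
(unit U3_Laws, (KMS) road «MODULO κ-STAGE B», brick κB-T «T-STRATA κ-SOCKETS», FILE 3∕3: THE FOUR TYPE-0 T-STRATA κ-SOCKETS; dealer LH4-plan (g11) WORD #35 (2);
head letters F0P3a-p01 (g32) 2026-09-04T01:25:48Z (B) VERBATIM; plan LH4-p05 (g3) `PLAN-KMS-modKappaStageB.v1` §4 rows «core» and «on-branch»).  2026-09-04.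
-/
import Summits.HodgeConjecture.HodgeConjecture.Theorems.F0P3cDyRamDiagonalKappaSplitCountValues   -- FILE 2 (this seat): `kappaCount_zero_latt_axis1∕2∕3`, `kappaCount_zero_stdLattice`; brings FILE 1, Fκ1∕Fκ2 (LH4-p05), ★ B4 sockets (LH4-p13), ★ LocalFields (`isAdicComplete_valuedInteger_of_completeSpace`, deep norms, level non-norm, ω-conductor toolkit)
import HarnessLib

/-!
# Crux `H413`, line LH4 «(D-RAM) FOUR-FRAME» road — unit U3_Laws (iii), (KMS) road «MODULO κ-STAGE B», brick κB-T FILE 3∕3: THE T-STRATA κ-SOCKETS (type 0) —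
# `Σᶠ_{M ∈ stratum(a)} κ_i(M)·w(M) = ω(−1)·[i = foot]·[2d ≤ s]·(★ B4 value)` on the three on-branch strata, `= 0` on the core

Cell `hodgecm-mathlib` (D-0151), FLOOR 0, crux item H413 = `stmt-HodgeConjecture-24833`, route of record `HCCMUnconditional`; squad F0∕P3c∕LH4 (req618∕req620); registered stub served:
`F0P3cDyRamFourFrameU3.stub_U3_kappaModelSum` (KMS; tree `Cruxes/H413/Lines/F0_P3c_DyRamFourFrame_U3_Laws.lean` ED. 7 :407–:429), via LH4-p05 (g3)'s reduction head
`…KappaModelSumOfKappaStageB` (binder `hBκ10`).  THEOREMS ONLY (no `def`, no instance, no notation, no `sorry`, default heartbeats); lane `--supports stmt-HodgeConjecture-24833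
--as helper` (count-neutral).  Section binders = ★ B4 `F0P3cDyRamDiagonalSplitCountSockets` §2 VERBATIM plus `[CompleteSpace K]` (F0P3a-p01 (g32) letter (A): without
completeness the sockets are false — `ℚ(i)` with the `(1+i)`-adic valuation); the non-norm unit and the dichotomy are NOT binders (★ `exists_nonnorm_dichotomy_of_isRamifiedQuadraticDatum`).

THE MATHEMATICS (PLAN v1 §4).  On the on-branch stratum `T_{i₀}(s)` (axis `a` with `a_{i₀} = 0`, the other two entries `s`) the κ-weight is CONSTANT: by FILE 2 every member
`M_{i₀}(s,·)` has `kappaCount σ ϖ 0 i M = ω(−1)` if `i = i₀` and `2d ≤ s` (the pair congruence depth `s∕2` of `S_F(M)` reaches the conductor exponent `d` of `ω_{K∕F}` — Serre V §3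
Cor. 3: ★ deep norms above, ★ level non-norm below), and `0` otherwise; so the κ-socket is that constant times the ★ B4 socket `Σᶠ w = q^{s∕2}·[2 ∣ s ∧ s ≤ n_{i₀}]`
(★ `finsum_stabiliserWeight_hasAxis_T1∕T2∕T3`).  On the core `(0,0,0) = {𝒪³}` every `κ_i` vanishes (FILE 2 `kappaCount_zero_stdLattice`).

WHAT IS PROVED (`{K : Type} [Fintype 𝓀[K]] [CompleteSpace K]`; statements = F0P3a-p01 (g32) letters (B) token for token).
* `finsum_kappaCount_mul_stabiliserWeight_hasAxis_T3 (hD) (hE) (hT) (s) (hs) (i)` — axis `(s,s,0)`, foot `i = 2`, depth letter `n₃`.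
* `finsum_kappaCount_mul_stabiliserWeight_hasAxis_T1` — axis `(0,s,s)`, foot `i = 0`, `n₁`;  `…_T2` — axis `(s,0,s)`, foot `i = 1`, `n₂`.
* `finsum_kappaCount_mul_stabiliserWeight_hasAxis_core` — axis `(0,0,0)`: `= 0`.
HONEST LABEL.  Count-neutral (`--supports`); nothing printed is asserted; (KMS) stays a PROVER TARGET (empirical census law in diagonal-model currency; the κ-Stage-B table of PLAN v1 §4
is its paper proof); `HC_CM` is proved only modulo the 7 printed citations (2 remaining named inputs: hLiu418 = `stmt-HodgeConjecture-24832`, h413 = `stmt-HodgeConjecture-24833`) until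
rung 0 closes.

## References
* [Kottwitz1986BaseChangeUnits] R. E. Kottwitz, *Base change for unit elements of Hecke algebras*, Compositio Math. 60 (1986), §1 pp. 240–241 (κ-orbital integrals of units as
  signed lattice counts modulo the torus).
* [Rogawski1990] J. D. Rogawski, *Automorphic Representations of Unitary Groups in Three Variables*, Ann. of Math. Stud. 123 (1990), §4.9 Prop. 4.9.1 (a) p. 55, §4.10 p. 58.
* [Serre1979] J.-P. Serre, *Local Fields*, GTM 67 (1979), Ch. V §3 Prop. 5, Cor. 3 (the conductor of a ramified quadratic extension).
-/

set_option autoImplicit false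

noncomputable section

namespace Summit.HodgeConjecture.HodgeConjecture.Cruxes.H413.F0P3cDyRamDiagonalKappaSplitCountSockets

open Matrix
open Literature.NumberTheory.Automorphic Literature.NumberTheory.Automorphic.HermitianLattice
open Literature.NumberTheory.Automorphic.UnitaryLatticeTree Literature.NumberTheory.Automorphic.UnitaryThreeFourFrame
open Literature.NumberTheory.LocalFields Literature.NumberTheory.LocalFields.WildQuadraticDatum
open Summit.HodgeConjecture.HodgeConjecture.Cruxes.H413.F0P3cDyRamDiagonalTorusDefs
open Summit.HodgeConjecture.HodgeConjecture.Cruxes.H413.F0P3cDyRamDiagonalStrataDefs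
open Summit.HodgeConjecture.HodgeConjecture.Cruxes.H413.F0P3cDyRamDiagonalKappaCountDefs
open Summit.HodgeConjecture.HodgeConjecture.Cruxes.H413.F0P3cDyRamDiagonalSplitCount
open Summit.HodgeConjecture.HodgeConjecture.Cruxes.H413.F0P3cDyRamDiagonalSplitCountAxisOne
open Summit.HodgeConjecture.HodgeConjecture.Cruxes.H413.F0P3cDyRamDiagonalSplitCountAxisTwo
open Summit.HodgeConjecture.HodgeConjecture.Cruxes.H413.F0P3cDyRamDiagonalSplitCountSockets
open Summit.HodgeConjecture.HodgeConjecture.Cruxes.H413.F0P3cDyRamDiagonalCoreUnique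
open Summit.HodgeConjecture.HodgeConjecture.Cruxes.H413.F0P3cDyRamDiagonalKappaSplitCountValues
open scoped Valued WithZero Matrix MatrixGroups

section Sockets

variable {K : Type} [Field K] [Valued K ℤᵐ⁰] [Fintype 𝓀[K]] [CompleteSpace K] {σ : K →+* K} {ϖ : K} {d t : ℕ} {α β : K} {N₀ n₁ n₂ n₃ : ℕ} {T : GL (Fin 3) K}

/-- Bookkeeping: `((if A then e else 0 : ℤ) : ℚ) · (if B then x else 0) = if A ∧ B then e·x else 0`. [folklore] -/
theorem cast_ite_mul_ite (A B : Prop) [Decidable A] [Decidable B] (e : ℤ) (x : ℚ) :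
    ((if A then e else 0 : ℤ) : ℚ) * (if B then x else 0) = if A ∧ B then (e : ℚ) * x else 0 := by
  by_cases hA : A <;> by_cases hB : B <;> simp [hA, hB]

/-- **κ-SOCKET, AXIS `(s,s,0)` (plane `⟨e₀,e₁⟩`, foot index `2`, depth letter `n₃ = v(α − β)`)**: `Σᶠ_{M ∈ stratum (s,s,0)} κ_i(M)·w(M) = ω(−1)·q^{s∕2}` if `i = 2`, `2d ≤ s`, `2 ∣ s`,
`s ≤ n₃`, and `0` otherwise (FILE 2 `kappaCount_zero_latt_axis3` is constant on the stratum; ★ B4 `finsum_stabiliserWeight_hasAxis_T3`).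
[cite: Kottwitz1986BaseChangeUnits, §1 pp. 240–241] [cite: Rogawski1990, §4.9 Prop. 4.9.1 (a) p. 55] [cite: Serre1979, Ch. V §3 Prop. 5, Cor. 3] -/
theorem finsum_kappaCount_mul_stabiliserWeight_hasAxis_T3 (hD : IsRamifiedQuadraticDatum σ ϖ d t) (hE : IsElementDatum σ ϖ N₀ α β n₁ n₂ n₃)
    (hT : (T : Matrix (Fin 3) (Fin 3) K) = Matrix.diagonal ![α, β, 1]) (s : ℕ) (hs : 1 ≤ s) (i : Fin 3) :
    ∑ᶠ M ∈ stratum σ ϖ T ![s, s, 0], (kappaCount σ ϖ 0 i M : ℚ) * stabiliserWeight σ M =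
      if i = 2 ∧ 2 * d ≤ s ∧ 2 ∣ s ∧ s ≤ n₃ then (normSign σ (-1 : K) : ℚ) * (Fintype.card 𝓀[K] : ℚ) ^ (s / 2) else 0 := by
  have hD' := hD
  obtain ⟨-, hvσ, hϖ, hfix, -, -, -⟩ := hD'
  haveI : IsAdicComplete 𝓂[K] 𝒪[K] := isAdicComplete_valuedInteger_of_completeSpace hϖ
  have hκ : ∀ M ∈ stratum σ ϖ T ![s, s, 0], (kappaCount σ ϖ 0 i M : ℚ) * stabiliserWeight σ M =
      ((if i = 2 ∧ 2 * d ≤ s then normSign σ (-1 : K) else 0 : ℤ) : ℚ) * stabiliserWeight σ M := by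
    rintro M ⟨hM, hdual, hax⟩
    obtain ⟨x, hx, rfl⟩ := (hasAxis_axis3_iff hϖ hM hs).1 hax
    rw [kappaCount_zero_latt_axis3 hD hx (two_dvd_of_isDualisableLattice_latt_axis3 hvσ hfix hϖ hx hdual) i]
  rw [finsum_mem_congr rfl hκ, ← mul_finsum_mem, finsum_stabiliserWeight_hasAxis_T3 hD hE hT s hs, cast_ite_mul_ite]
  simp only [and_assoc]

/-- **κ-SOCKET, AXIS `(0,s,s)` (plane `⟨e₁,e₂⟩`, foot index `0`, depth letter `n₁ = v(β − 1)`)**: `ω(−1)·q^{s∕2}` if `i = 0 ∧ 2d ≤ s ∧ 2 ∣ s ∧ s ≤ n₁`, else `0`.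
[cite: Kottwitz1986BaseChangeUnits, §1 pp. 240–241] [cite: Rogawski1990, §4.9 Prop. 4.9.1 (a) p. 55] [cite: Serre1979, Ch. V §3 Prop. 5, Cor. 3] -/
theorem finsum_kappaCount_mul_stabiliserWeight_hasAxis_T1 (hD : IsRamifiedQuadraticDatum σ ϖ d t) (hE : IsElementDatum σ ϖ N₀ α β n₁ n₂ n₃)
    (hT : (T : Matrix (Fin 3) (Fin 3) K) = Matrix.diagonal ![α, β, 1]) (s : ℕ) (hs : 1 ≤ s) (i : Fin 3) :
    ∑ᶠ M ∈ stratum σ ϖ T ![0, s, s], (kappaCount σ ϖ 0 i M : ℚ) * stabiliserWeight σ M =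
      if i = 0 ∧ 2 * d ≤ s ∧ 2 ∣ s ∧ s ≤ n₁ then (normSign σ (-1 : K) : ℚ) * (Fintype.card 𝓀[K] : ℚ) ^ (s / 2) else 0 := by
  have hD' := hD
  obtain ⟨-, hvσ, hϖ, hfix, -, -, -⟩ := hD'
  haveI : IsAdicComplete 𝓂[K] 𝒪[K] := isAdicComplete_valuedInteger_of_completeSpace hϖ
  have hκ : ∀ M ∈ stratum σ ϖ T ![0, s, s], (kappaCount σ ϖ 0 i M : ℚ) * stabiliserWeight σ M =
      ((if i = 0 ∧ 2 * d ≤ s then normSign σ (-1 : K) else 0 : ℤ) : ℚ) * stabiliserWeight σ M := by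
    rintro M ⟨hM, hdual, hax⟩
    obtain ⟨z, hz, rfl⟩ := (hasAxis_axis1_iff hϖ hM hs).1 hax
    rw [kappaCount_zero_latt_axis1 hD hz (two_dvd_of_isDualisableLattice_latt_axis1 hvσ hfix hϖ hz hdual) i]
  rw [finsum_mem_congr rfl hκ, ← mul_finsum_mem, finsum_stabiliserWeight_hasAxis_T1 hD hE hT s hs, cast_ite_mul_ite]
  simp only [and_assoc]

/-- **κ-SOCKET, AXIS `(s,0,s)` (plane `⟨e₀,e₂⟩`, foot index `1`, depth letter `n₂ = v(α − 1)`)**: `ω(−1)·q^{s∕2}` if `i = 1 ∧ 2d ≤ s ∧ 2 ∣ s ∧ s ≤ n₂`, else `0`.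
[cite: Kottwitz1986BaseChangeUnits, §1 pp. 240–241] [cite: Rogawski1990, §4.9 Prop. 4.9.1 (a) p. 55] [cite: Serre1979, Ch. V §3 Prop. 5, Cor. 3] -/
theorem finsum_kappaCount_mul_stabiliserWeight_hasAxis_T2 (hD : IsRamifiedQuadraticDatum σ ϖ d t) (hE : IsElementDatum σ ϖ N₀ α β n₁ n₂ n₃)
    (hT : (T : Matrix (Fin 3) (Fin 3) K) = Matrix.diagonal ![α, β, 1]) (s : ℕ) (hs : 1 ≤ s) (i : Fin 3) :
    ∑ᶠ M ∈ stratum σ ϖ T ![s, 0, s], (kappaCount σ ϖ 0 i M : ℚ) * stabiliserWeight σ M =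
      if i = 1 ∧ 2 * d ≤ s ∧ 2 ∣ s ∧ s ≤ n₂ then (normSign σ (-1 : K) : ℚ) * (Fintype.card 𝓀[K] : ℚ) ^ (s / 2) else 0 := by
  have hD' := hD
  obtain ⟨-, hvσ, hϖ, hfix, -, -, -⟩ := hD'
  haveI : IsAdicComplete 𝓂[K] 𝒪[K] := isAdicComplete_valuedInteger_of_completeSpace hϖ
  have hκ : ∀ M ∈ stratum σ ϖ T ![s, 0, s], (kappaCount σ ϖ 0 i M : ℚ) * stabiliserWeight σ M =
      ((if i = 1 ∧ 2 * d ≤ s then normSign σ (-1 : K) else 0 : ℤ) : ℚ) * stabiliserWeight σ M := by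
    rintro M ⟨hM, hdual, hax⟩
    obtain ⟨y, hy, rfl⟩ := (hasAxis_axis2_iff hϖ hM hs).1 hax
    rw [kappaCount_zero_latt_axis2 hD hy (two_dvd_of_isDualisableLattice_latt_axis2 hvσ hfix hϖ hy hdual) i]
  rw [finsum_mem_congr rfl hκ, ← mul_finsum_mem, finsum_stabiliserWeight_hasAxis_T2 hD hE hT s hs, cast_ite_mul_ite]
  simp only [and_assoc]

/-- **κ-SOCKET, THE CORE `(0,0,0)`**: the stratum is `{𝒪³}` (a normalised lattice containing `e₀, e₁, e₂`), and `κ_i(𝒪³) = 0` for every `i` (FILE 2 `kappaCount_zero_stdLattice`), so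
the sum is `0` (the element-datum binders `_hE`, `_hT` are kept only for the uniform socket shape; the core needs neither). [cite: Kottwitz1986BaseChangeUnits, §1 pp. 240–241]
[cite: Rogawski1990, §4.10 p. 58] -/
theorem finsum_kappaCount_mul_stabiliserWeight_hasAxis_core (hD : IsRamifiedQuadraticDatum σ ϖ d t) (_hE : IsElementDatum σ ϖ N₀ α β n₁ n₂ n₃)
    (_hT : (T : Matrix (Fin 3) (Fin 3) K) = Matrix.diagonal ![α, β, 1]) (i : Fin 3) :
    ∑ᶠ M ∈ stratum σ ϖ T ![0, 0, 0], (kappaCount σ ϖ 0 i M : ℚ) * stabiliserWeight σ M = 0 := by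
  have hD' := hD
  obtain ⟨-, -, hϖ, -, -, -, -⟩ := hD'
  haveI : IsAdicComplete 𝓂[K] 𝒪[K] := isAdicComplete_valuedInteger_of_completeSpace hϖ
  -- a member of the core stratum is `𝒪³`: it lies in `𝒪³` (normalised) and contains `e₀, e₁, e₂` (axis `(0,0,0)`)
  have hroot : ∀ M ∈ stratum σ ϖ T ![0, 0, 0], M = stdLattice K 3 := by
    rintro M ⟨⟨-, -, hN⟩, -, hax⟩
    refine le_antisymm (fun w hw => mem_stdLattice.2 fun j => (hN j).1 w hw) (fun w hw => ?_)
    have hw' : ∀ j, Valued.v (w j) ≤ 1 := fun j => mem_stdLattice.1 hw j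
    rw [← Finset.univ_sum_single w]
    refine M.sum_mem fun k _ => ?_
    have e0 : ((![0, 0, 0] : Fin 3 → ℕ) k) = 0 := by fin_cases k <;> rfl
    have hk : (Pi.single k (1 : K) : Fin 3 → K) ∈ M := (hax k 1).2 (by rw [e0, pow_zero, map_one])
    have hmem := M.smul_mem (⟨w k, hw' k⟩ : 𝒪[K]) hk
    have heq : ((⟨w k, hw' k⟩ : 𝒪[K]) • (Pi.single k (1 : K) : Fin 3 → K)) = Pi.single k (w k) := by
      change (w k : K) • (Pi.single k (1 : K) : Fin 3 → K) = Pi.single k (w k)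
      rw [← Pi.single_smul, smul_eq_mul, mul_one]
    rwa [heq] at hmem
  have hκ : ∀ M ∈ stratum σ ϖ T ![0, 0, 0], (kappaCount σ ϖ 0 i M : ℚ) * stabiliserWeight σ M = 0 := fun M hM => by
    rw [hroot M hM, kappaCount_zero_stdLattice hD i, Int.cast_zero, zero_mul]
  rw [finsum_mem_congr rfl hκ]
  simp

end Sockets

end Summit.HodgeConjecture.HodgeConjecture.Cruxes.H413.F0P3cDyRamDiagonalKappaSplitCountSockets

end
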